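import Mathlib
import Literature.NumberTheory.LFunctions.WeilExplicit
import Literature.NumberTheory.LFunctions.WeilGroundState
import Literature.NumberTheory.LFunctions.RiemannXi
import Literature.NumberTheory.LFunctions.RiemannXiFourier

/-!
# `GroundStatesConvergeToXi`, line `Sketch` — stub `stub_pointwise_of_weak`

Crux item `stmt-RiemannHypothesis-1527` (route `WeilGroundState`), transfer architecture through
Riemann's kernel `Φ(t) = 2Ψ(2t)` (`LagariasMontague.Psic`), whose transform is `ξ`.

This file proves the RH-free step **weak ⇒ pointwise**: if the renormalised ground states
`c_k u_k` are TIGHT in every weighted `L¹(e^{b|t|} dt)`, `b < 1/2`, and converge WEAKLY (against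
smooth compactly supported test functions) to `Φ`, then `c_k û_k(σ) → ξ(σ)` for every real
`σ ∈ (0, 1)`, where `û = weilMellin u`, `û(s) = ∫ u(t) e^{(s - 1/2)t} dt`.

Proof (ε/2 argument). Put `s₀ = |σ − 1/2| < b := (s₀ + 1/2)/2 < 1/2` and let `χ_R` be a smooth
bump equal to `1` on `[−R, R]` (`ContDiffBump`). Split the weight
`e^{(σ−1/2)t} = χ_R(t) e^{(σ−1/2)t} + (1 − χ_R(t)) e^{(σ−1/2)t}`. The first piece
`g_R = χ_R e^{(σ−1/2)·}` is a Weil test function, so `∫ c_k u_k g_R → ∫ Φ g_R` by weak convergence;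
the second piece is bounded by `e^{−(b−s₀)R} e^{b|t|}`, so its pairings with `c_k u_k` and `Φ`
are `≤ e^{−(b−s₀)R} M_b` and `≤ e^{−(b−s₀)R} ∫ |Φ| e^{b|t|}` uniformly in `k`. Choosing `R` large
and then `k` large gives `|c_k û_k(σ) − ξ(σ)| < ε`, using `Φ̂(σ) = ξ(σ)`.

Mathlib (`ContDiffBump`, Bochner integral) + the tree's `WeilExplicit` / `WeilGroundState` API
(`IsWeilGroundState.integrable_mul_continuous`) and `RiemannXiFourier` (`continuous_Psic`) only;
no named fact is used; no definitions. Helper file (`--supports`), namespace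
`…Theorems.GroundStatesConvergeToXi`; all helpers are prefixed `stub_pointwise_of_weak_`.
-/

set_option linter.dupNamespace false

noncomputable section

open MeasureTheory Complex Filter Set
open scoped Real Topology ContDiff

namespace Summit.RiemannHypothesis.RiemannHypothesis.Theorems.GroundStatesConvergeToXi

open Literature.NumberTheory.LFunctions

/-! ### Auxiliary estimates -/

/-- The modulus of the weight of `weilMellin` at a real point: `|e^{(σ-1/2)t}| = e^{(σ-1/2)t}`.
[folklore] -/
theorem stub_pointwise_of_weak_norm_cexp (σ t : ℝ) :
    ‖cexp ((↑σ - 1 / 2) * ↑t)‖ = Real.exp ((σ - 1 / 2) * t) := by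
  have h : ((↑σ - 1 / 2) * ↑t : ℂ) = (((σ - 1 / 2) * t : ℝ) : ℂ) := by push_cast; ring
  rw [h, Complex.norm_exp, Complex.ofReal_re]

/-- `|e^{(σ-1/2)t}| ≤ e^{b|t|}` whenever `|σ - 1/2| ≤ b`. [folklore] -/
theorem stub_pointwise_of_weak_norm_cexp_le {σ b : ℝ} (hb : |σ - 1 / 2| ≤ b) (t : ℝ) :
    ‖cexp ((↑σ - 1 / 2) * ↑t)‖ ≤ Real.exp (b * |t|) := by
  rw [stub_pointwise_of_weak_norm_cexp, Real.exp_le_exp]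
  calc (σ - 1 / 2) * t ≤ |(σ - 1 / 2) * t| := le_abs_self _
    _ = |σ - 1 / 2| * |t| := abs_mul _ _
    _ ≤ b * |t| := mul_le_mul_of_nonneg_right hb (abs_nonneg _)

/-- **Tail weight.** If `0 ≤ x ≤ 1` and `x = 1` whenever `|t| ≤ R`, then for `|σ - 1/2| ≤ b`,
`|(1 - x) e^{(σ-1/2)t}| ≤ e^{-(b - |σ-1/2|) R} e^{b|t|}` (the left side vanishes for `|t| ≤ R`,
and `e^{|σ-1/2||t|} = e^{b|t|} e^{-(b-|σ-1/2|)|t|}` for `|t| > R`). [folklore] -/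
theorem stub_pointwise_of_weak_norm_tail_le {x t R σ b : ℝ} (hx0 : 0 ≤ x) (hx1 : x ≤ 1)
    (h1 : |t| ≤ R → x = 1) (hb : |σ - 1 / 2| ≤ b) :
    ‖(1 - (x : ℂ)) * cexp ((↑σ - 1 / 2) * ↑t)‖ ≤
      Real.exp (-((b - |σ - 1 / 2|) * R)) * Real.exp (b * |t|) := by
  rcases le_or_gt |t| R with ht | ht
  · rw [h1 ht, Complex.ofReal_one, sub_self, zero_mul, norm_zero]
    positivity
  · rw [norm_mul, stub_pointwise_of_weak_norm_cexp]
    have hx : ‖(1 - (x : ℂ))‖ ≤ 1 := by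
      rw [show (1 - (x : ℂ)) = ((1 - x : ℝ) : ℂ) by push_cast; ring, Complex.norm_real,
        Real.norm_eq_abs, abs_of_nonneg (by linarith)]
      linarith
    have he : Real.exp ((σ - 1 / 2) * t) ≤
        Real.exp (-((b - |σ - 1 / 2|) * R)) * Real.exp (b * |t|) := by
      rw [← Real.exp_add, Real.exp_le_exp]
      have h2 : (σ - 1 / 2) * t ≤ |σ - 1 / 2| * |t| := by
        rw [← abs_mul]; exact le_abs_self _
      have h3 : (b - |σ - 1 / 2|) * R ≤ (b - |σ - 1 / 2|) * |t| :=
        mul_le_mul_of_nonneg_left ht.le (sub_nonneg.2 hb)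
      linarith
    calc ‖(1 - (x : ℂ))‖ * Real.exp ((σ - 1 / 2) * t)
        ≤ 1 * Real.exp ((σ - 1 / 2) * t) :=
          mul_le_mul_of_nonneg_right hx (Real.exp_pos _).le
      _ ≤ Real.exp (-((b - |σ - 1 / 2|) * R)) * Real.exp (b * |t|) := by rwa [one_mul]

/-- **Weighted `L¹` pairing, integrability.** If `|v| e^{b|t|}` is integrable and the continuous
weight `w` satisfies `|w(t)| ≤ K e^{b|t|}`, then `v · w` is integrable. [folklore] -/
theorem stub_pointwise_of_weak_integrable_mul {v w : ℝ → ℂ} {b K : ℝ}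
    (hv : AEStronglyMeasurable v volume)
    (hI : Integrable fun t => ‖v t‖ * Real.exp (b * |t|))
    (hw : Continuous w) (hwb : ∀ t, ‖w t‖ ≤ K * Real.exp (b * |t|)) :
    Integrable fun t => v t * w t :=
  (hI.const_mul K).mono' (hv.mul hw.aestronglyMeasurable) (ae_of_all _ fun t => by
    rw [norm_mul]
    calc ‖v t‖ * ‖w t‖ ≤ ‖v t‖ * (K * Real.exp (b * |t|)) :=
          mul_le_mul_of_nonneg_left (hwb t) (norm_nonneg _)
      _ = K * (‖v t‖ * Real.exp (b * |t|)) := by ring)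

/-- **Weighted `L¹` pairing, bound.** If `|v| e^{b|t|}` is integrable and `|w(t)| ≤ K e^{b|t|}`
(no sign condition on `K` is needed), then `|∫ v w| ≤ K ∫ |v| e^{b|t|}`. [folklore] -/
theorem stub_pointwise_of_weak_norm_integral_mul_le {v w : ℝ → ℂ} {b K : ℝ}
    (hI : Integrable fun t => ‖v t‖ * Real.exp (b * |t|))
    (hwb : ∀ t, ‖w t‖ ≤ K * Real.exp (b * |t|)) :
    ‖∫ t, v t * w t‖ ≤ K * ∫ t, ‖v t‖ * Real.exp (b * |t|) := by
  rw [← integral_const_mul]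
  exact norm_integral_le_of_norm_le (hI.const_mul K) (ae_of_all _ fun t => by
    rw [norm_mul]
    calc ‖v t‖ * ‖w t‖ ≤ ‖v t‖ * (K * Real.exp (b * |t|)) :=
          mul_le_mul_of_nonneg_left (hwb t) (norm_nonneg _)
      _ = K * (‖v t‖ * Real.exp (b * |t|)) := by ring)

/-- Splitting a pairing along a decomposition `w = w₁ + w₂` of the weight. [folklore] -/
theorem stub_pointwise_of_weak_integral_split {v w w₁ w₂ : ℝ → ℂ}
    (hw : ∀ t, w t = w₁ t + w₂ t)
    (h₁ : Integrable fun t => v t * w₁ t) (h₂ : Integrable fun t => v t * w₂ t) :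
    ∫ t, v t * w t = (∫ t, v t * w₁ t) + ∫ t, v t * w₂ t := by
  rw [← integral_add h₁ h₂]
  exact integral_congr_ae (ae_of_all _ fun t => by simp only [hw, mul_add])

/-- A smooth bump times an exponential `e^{zt}` is a Weil test function (smooth, compact support;
cf. `exists_isWeilTest_sphere`). [folklore] -/
theorem stub_pointwise_of_weak_isWeilTest (χ : ContDiffBump (0 : ℝ)) (z : ℂ) :
    IsWeilTest fun t : ℝ => (χ t : ℂ) * cexp (z * t) :=
  ⟨(Complex.ofRealCLM.contDiff.comp χ.contDiff).mul
      (contDiff_const.mul Complex.ofRealCLM.contDiff).cexp,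
    (χ.hasCompactSupport.comp_left Complex.ofReal_zero).mul_right⟩

/-- For a ground state `u` and a scalar `c`, `|c u| e^{b|t|}` is integrable (the window is
compact and `u` vanishes a.e. off it, `IsWeilGroundState.integrable_mul_continuous`), so the
tightness hypothesis below is about genuine integrals. [folklore] -/
theorem stub_pointwise_of_weak_integrable_weight {a : ℝ} {u : ℝ → ℂ}
    (hu : IsWeilGroundState a u) (c : ℂ) (b : ℝ) :
    Integrable fun t => ‖c * u t‖ * Real.exp (b * |t|) := by
  have h := (hu.integrable_mul_continuous
    (w := fun t : ℝ => c * ((Real.exp (b * |t|) : ℝ) : ℂ)) (by fun_prop)).norm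
  refine h.congr (ae_of_all _ fun t => ?_)
  simp only [norm_mul, Complex.norm_real, Real.norm_of_nonneg (Real.exp_pos _).le]
  ring

/-! ### The stub -/

/-- **Stub `pointwise_of_weak` (RH-free).** For ground states `u_k` and scalars `c_k`:
TIGHTNESS in every weighted `L¹(e^{b|t|} dt)`, `b < 1/2`, plus WEAK convergence of `c_k u_k` to
`Φ = 2Ψ(2·)` against test functions give pointwise convergence `c_k û_k(σ) → ξ(σ)` at every real
`σ ∈ (0, 1)`: write `c_k û_k(σ) − ξ(σ) = ∫ (c_k u_k − Φ) e^{(σ−1/2)t}` (`hxi`), split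
`e^{(σ−1/2)t} = χ_R e^{(σ−1/2)t} + (1 − χ_R) e^{(σ−1/2)t}` with a smooth cutoff `χ_R`
(`ContDiffBump`); the first pairing tends to `0` in `k` (a test function), the second is
`≤ e^{-(b−|σ−1/2|)R} (M_b + ∫|Φ|e^{b|t|})` uniformly in `k` for `b = (|σ − 1/2| + 1/2)/2`. The
decay hypothesis `hdecay` (at rate `0`) bounds `Φ`, making `Φ · g` integrable for test `g`.
[folklore] -/
theorem stub_pointwise_of_weak
    (hdecay : ∀ c : ℝ, ∃ C : ℝ, ∀ t : ℝ, |LagariasMontague.Psi t| ≤ C * Real.exp (-(c * |t|)))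
    (hint : ∀ c : ℝ, Integrable (fun t : ℝ => LagariasMontague.Psi (2 * t) * Real.exp (c * |t|)))
    (hxi : ∀ s : ℂ, weilMellin (fun t : ℝ => 2 * LagariasMontague.Psic (2 * t)) s = riemannXi s)
    {a : ℕ → ℝ} {u : ℕ → ℝ → ℂ} {c : ℕ → ℂ}
    (hu : ∀ k, IsWeilGroundState (a k) (u k))
    (htight : ∀ b : ℝ, b < 1 / 2 → ∃ M : ℝ, ∀ k, ∫ t, ‖c k * u k t‖ * Real.exp (b * |t|) ≤ M)
    (hweak : ∀ g : ℝ → ℂ, IsWeilTest g →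
      Tendsto (fun k => ∫ t, c k * u k t * g t) atTop
        (𝓝 (∫ t, 2 * LagariasMontague.Psic (2 * t) * g t)))
    (σ : ℝ) (hσ : σ ∈ Ioo (0 : ℝ) 1) :
    Tendsto (fun k => c k * weilMellin (u k) σ) atTop (𝓝 (riemannXi σ)) := by
  obtain ⟨hσ0, hσ1⟩ := hσ
  set Φ : ℝ → ℂ := fun t => 2 * LagariasMontague.Psic (2 * t) with hΦ
  -- exponents
  set s₀ : ℝ := |σ - 1 / 2| with hs₀
  have hs₀lt : s₀ < 1 / 2 := by
    rw [hs₀, abs_lt]; constructor <;> linarith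
  set b : ℝ := (s₀ + 1 / 2) / 2 with hb
  have hsb : s₀ ≤ b := by rw [hb]; linarith
  have hb2 : b < 1 / 2 := by rw [hb]; linarith
  have hδ : 0 < b - s₀ := by rw [hb]; linarith
  obtain ⟨M, hM⟩ := htight b hb2
  -- `Φ` is continuous and bounded (decay at rate `0`), `|Φ| e^{b|t|}` is integrable
  have hΦc : Continuous Φ :=
    continuous_const.mul
      (LagariasMontague.continuous_Psic.comp (continuous_const.mul continuous_id))
  have hnΦ : ∀ t, ‖Φ t‖ = 2 * |LagariasMontague.Psi (2 * t)| := fun t => by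
    simp [hΦ, LagariasMontague.Psic]
  obtain ⟨C₀, hC₀⟩ := hdecay 0
  have hΦbdd : ∀ t, ‖Φ t‖ ≤ 2 * C₀ := fun t => by
    rw [hnΦ]
    have := hC₀ (2 * t)
    simp only [zero_mul, neg_zero, Real.exp_zero, mul_one] at this
    linarith
  have IΦ : Integrable fun t => ‖Φ t‖ * Real.exp (b * |t|) := by
    refine ((hint b).norm.const_mul 2).congr (ae_of_all _ fun t => ?_)
    show 2 * ‖LagariasMontague.Psi (2 * t) * Real.exp (b * |t|)‖ = ‖Φ t‖ * Real.exp (b * |t|)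
    rw [hnΦ, Real.norm_eq_abs, abs_mul, abs_of_pos (Real.exp_pos _)]
    ring
  set MΦ : ℝ := ∫ t, ‖Φ t‖ * Real.exp (b * |t|)
  have Iv : ∀ k, Integrable fun t => ‖c k * u k t‖ * Real.exp (b * |t|) := fun k =>
    stub_pointwise_of_weak_integrable_weight (hu k) (c k) b
  have hvm : ∀ k, AEStronglyMeasurable (fun t => c k * u k t) volume := fun k =>
    (hu k).memLp.1.const_mul (c k)
  -- the limit `R → ∞` of the tail bound
  have hlim : Tendsto (fun R : ℝ => Real.exp (-((b - s₀) * R)) * (M + MΦ)) atTop (𝓝 0) := by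
    have h1 : Tendsto (fun R : ℝ => Real.exp (-((b - s₀) * R))) atTop (𝓝 0) :=
      Real.tendsto_exp_neg_atTop_nhds_zero.comp (tendsto_id.const_mul_atTop hδ)
    simpa using h1.mul_const (M + MΦ)
  rw [Metric.tendsto_atTop]
  intro ε hε
  obtain ⟨R, hR1, hR⟩ :=
    ((eventually_ge_atTop (1 : ℝ)).and (hlim.eventually (gt_mem_nhds (half_pos hε)))).exists
  have hR0 : 0 < R := lt_of_lt_of_le one_pos hR1
  -- the smooth cutoff and the test function `g_R = χ e^{(σ-1/2)t}`
  let χ : ContDiffBump (0 : ℝ) := ⟨R, R + 1, hR0, by linarith⟩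
  have hχ1 : ∀ t : ℝ, |t| ≤ R → χ t = 1 := fun t ht =>
    χ.one_of_mem_closedBall (mem_closedBall_zero_iff.2 (by simpa [Real.norm_eq_abs] using ht))
  set gR : ℝ → ℂ := fun t => (χ t : ℂ) * cexp ((↑σ - 1 / 2) * ↑t) with hgR
  have hgRtest : IsWeilTest gR := stub_pointwise_of_weak_isWeilTest χ _
  set w₂ : ℝ → ℂ := fun t => (1 - (χ t : ℂ)) * cexp ((↑σ - 1 / 2) * ↑t) with hw₂
  have hw₂c : Continuous w₂ := by
    have := χ.continuous
    rw [hw₂]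
    fun_prop
  have hsplit : ∀ t : ℝ, cexp ((↑σ - 1 / 2) * ↑t) = gR t + w₂ t := fun t => by
    simp only [hgR, hw₂]; ring
  -- weight bounds
  have hgRb : ∀ t, ‖gR t‖ ≤ 1 * Real.exp (b * |t|) := fun t => by
    rw [hgR, norm_mul, Complex.norm_real, Real.norm_of_nonneg χ.nonneg, one_mul]
    calc χ t * ‖cexp ((↑σ - 1 / 2) * ↑t)‖ ≤ 1 * ‖cexp ((↑σ - 1 / 2) * ↑t)‖ :=
          mul_le_mul_of_nonneg_right χ.le_one (norm_nonneg _)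
      _ ≤ Real.exp (b * |t|) := by rw [one_mul]; exact stub_pointwise_of_weak_norm_cexp_le hsb t
  have hw₂b : ∀ t, ‖w₂ t‖ ≤ Real.exp (-((b - s₀) * R)) * Real.exp (b * |t|) := fun t =>
    stub_pointwise_of_weak_norm_tail_le χ.nonneg χ.le_one (hχ1 t) hsb
  -- integrability of the four pairings
  have IvgR : ∀ k, Integrable fun t => c k * u k t * gR t := fun k =>
    stub_pointwise_of_weak_integrable_mul (hvm k) (Iv k) hgRtest.1.continuous hgRb
  have Ivw₂ : ∀ k, Integrable fun t => c k * u k t * w₂ t := fun k =>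
    stub_pointwise_of_weak_integrable_mul (hvm k) (Iv k) hw₂c hw₂b
  have IΦgR : Integrable fun t => Φ t * gR t :=
    (hgRtest.1.continuous.integrable_of_hasCompactSupport hgRtest.2).bdd_mul
      hΦc.aestronglyMeasurable (ae_of_all _ hΦbdd)
  have IΦw₂ : Integrable fun t => Φ t * w₂ t :=
    stub_pointwise_of_weak_integrable_mul hΦc.aestronglyMeasurable IΦ hw₂c hw₂b
  -- decompositions of `c_k û_k(σ)` and `ξ(σ)`
  have hA : ∀ k, c k * weilMellin (u k) σ =
      (∫ t, c k * u k t * gR t) + ∫ t, c k * u k t * w₂ t := fun k => by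
    rw [← stub_pointwise_of_weak_integral_split hsplit (IvgR k) (Ivw₂ k), weilMellin,
      ← integral_const_mul]
    simp_rw [mul_assoc]
  have hB : riemannXi σ = (∫ t, Φ t * gR t) + ∫ t, Φ t * w₂ t := by
    rw [← stub_pointwise_of_weak_integral_split hsplit IΦgR IΦw₂, ← hxi]
    simp only [weilMellin, hΦ]
  -- head: weak convergence against the test function `g_R`
  have hhead := hweak gR hgRtest
  rw [Metric.tendsto_atTop] at hhead
  obtain ⟨K, hK⟩ := hhead (ε / 2) (half_pos hε)
  refine ⟨K, fun k hk => ?_⟩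
  have h1 : ‖(∫ t, c k * u k t * gR t) - ∫ t, Φ t * gR t‖ < ε / 2 := by
    rw [← dist_eq_norm]; exact hK k hk
  -- tails
  have h2 : ‖∫ t, c k * u k t * w₂ t‖ ≤ Real.exp (-((b - s₀) * R)) * M :=
    (stub_pointwise_of_weak_norm_integral_mul_le (Iv k) hw₂b).trans
      (mul_le_mul_of_nonneg_left (hM k) (Real.exp_pos _).le)
  have h3 : ‖∫ t, Φ t * w₂ t‖ ≤ Real.exp (-((b - s₀) * R)) * MΦ :=
    stub_pointwise_of_weak_norm_integral_mul_le IΦ hw₂b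
  rw [dist_eq_norm, hA k, hB]
  calc ‖(∫ t, c k * u k t * gR t) + (∫ t, c k * u k t * w₂ t) -
        ((∫ t, Φ t * gR t) + ∫ t, Φ t * w₂ t)‖
      = ‖((∫ t, c k * u k t * gR t) - ∫ t, Φ t * gR t) +
          ((∫ t, c k * u k t * w₂ t) - ∫ t, Φ t * w₂ t)‖ := by ring_nf
    _ ≤ ‖(∫ t, c k * u k t * gR t) - ∫ t, Φ t * gR t‖ +
          (‖∫ t, c k * u k t * w₂ t‖ + ‖∫ t, Φ t * w₂ t‖) :=
        (norm_add_le _ _).trans (add_le_add le_rfl (norm_sub_le _ _))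
    _ < ε / 2 + ε / 2 := by
        refine add_lt_add_of_lt_of_le h1 ?_
        calc ‖∫ t, c k * u k t * w₂ t‖ + ‖∫ t, Φ t * w₂ t‖
            ≤ Real.exp (-((b - s₀) * R)) * M + Real.exp (-((b - s₀) * R)) * MΦ :=
              add_le_add h2 h3
          _ = Real.exp (-((b - s₀) * R)) * (M + MΦ) := by ring
          _ ≤ ε / 2 := hR.le
    _ = ε := add_halves ε

end Summit.RiemannHypothesis.RiemannHypothesis.Theorems.GroundStatesConvergeToXi

end
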